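import Summits.QuantumAdvantage.QuantumAdvantage.Theses.LinnikCubicClassGroups
import Literature.Computability.Cryptography.CubicClassPostLabels
import Literature.Computability.Cryptography.CubicClassPostPairLaw
import Literature.Computability.Cryptography.CubicClassPostRows
import Literature.Computability.Cryptography.PeriodFindingIndependence
import Literature.Computability.Cryptography.HallgrenClassGroupQuantumSuccess

/-!
# Crux `LinnikCubicClassGroups.PureCubicClassGroupFBQP` (stmt-QuantumAdvantage-11544) — stub `stub_classPost` (S5b-P7)

Line `arakelov-giant-step-cycle`. **P7: the exact-modes / coprime-pairing post-processing succeeds** (`CubicClassSampling.ClaimPost`):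
`2n` independent Fourier-sampling units with law `w`, `ℓ¹`-close (`ε₃`) to a weight `w₁` obeying `UnitSamplingLaw` (inaccurate mass
`ε₁`, near-uniformity `ε₂` of the character given the residue), accuracy `δ` with `(4K₀+2) δ B² < 1` and `[ℤ^T : Λ] ≤ B`; then the
capped post-processor returns `[ℤ^T : Λ]` with probability `≥ 1 − 2n(ε₁+ε₃) − (B+1)^(log₂ B + 2) ((1+ε₂)²/2 + 3(ε₁+ε₃))^n`.

Proof (finite probability + finite abelian groups; the bricks are Literature files landed for this stub):
* the dual group `Λ^*/ℤ^T` is the annihilator `G = annih h Λ ≤ (ℤ/h)^T`, `|G| = h = [ℤ^T : Λ]` (`CubicClassPostDual`); an accurate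
  outcome `c` carries a residue `klab c` and ONE character with group label `glab c ∈ G`, and on an accurate pair the reduced row is
  EXACTLY the representative of `sG c c' = c₁ glab c + c₂ glab c' ∈ G` plus integers (`CubicClassPostLabels`,
  `CubicClassPostRecover`), so when all units are accurate and these combinations generate `G` the capped post-processor returns
  `|G| = h` (`postOutC_eq_of_generate`, via `CubicClassPostRows.subgroupOrderPure_natRows_eq_card`);
* failure ⊆ {some unit inaccurate} ∪ ⋃_{H < G} {every pair accurate with combination in `H`}: the first has probability
  `≤ 2n (ε₁ + ε₃)`, each of the `≤ (h+1)^{log₂ h}` events of the second has probability `≤ ((1+ε₂)²/2 · (1+ε₃)²)^n`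
  (`CubicClassPostPairLaw.sum_pair_event_le`, product law `PeriodFinding.prob_forall_not_eq_prod`), and
  `(1+ε₂)²/2 (1+ε₃)² ≤ (1+ε₂)²/2 + 3(ε₁+ε₃)` unless the claimed bound is `≤ 0`.
-/

set_option linter.dupNamespace false

noncomputable section

open scoped Classical

namespace Summit.QuantumAdvantage.QuantumAdvantage.Theorems.LinnikCubicClassGroups

open Literature.Computability.Cryptography
open Literature.Computability.Cryptography.CubicClassSampling
open Literature.Computability.Cryptography.CubicClassPost
open Finset

/-! ### Correctness on the good event -/

section Correct

variable {P : PostParams} {Λ : AddSubgroup (Fin P.T → ℤ)} [Λ.FiniteIndex] {μ' : Fin P.T → ℝ} {δ : ℝ} {h : ℕ} [NeZero h]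
  {n : ℕ}

/-- The first unit of pair `i`. [folklore] -/
def pa (n : ℕ) (i : Fin n) : Fin (2 * n) := ⟨2 * i, by omega⟩

/-- The second unit of pair `i`. [folklore] -/
def pb (n : ℕ) (i : Fin n) : Fin (2 * n) := ⟨2 * i + 1, by omega⟩

omit [Λ.FiniteIndex] [NeZero h] in
/-- The pairs are disjoint. [folklore] -/
theorem disjointPairs_pa_pb (n : ℕ) : PeriodFinding.DisjointPairs (pa n) (pb n) where
  inj_a i j hij := by have := congrArg Fin.val hij; simp only [pa] at this; exact Fin.ext (by omega)
  inj_b i j hij := by have := congrArg Fin.val hij; simp only [pb] at this; exact Fin.ext (by omega)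
  a_ne_b i j hij := by have := congrArg Fin.val hij; simp only [pa, pb] at this; omega

/-- **Correctness on the good event**: if all `2n` outcomes are accurate and the combined group elements of the `n` pairs
generate `annih h Λ`, the capped post-processor returns `h = [ℤ^T : Λ]`. [cite: Hallgren2005, §4; CheungMosca2001, §3] -/
theorem postOutC_eq_of_generate (hh : Λ.index = h) (hhB : h ≤ P.B) (hδ : 0 ≤ δ)
    (hδK : (4 * (P.K₀ : ℝ) + 2) * δ * (P.B : ℝ) ^ 2 < 1) {Q : ℕ} (cs : Fin (2 * n) → Fin Q)
    (hacc : ∀ u, (cs u : ℕ) ∈ AccAll P Λ μ' δ)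
    (hgen : AddSubgroup.closure (Set.range fun i : Fin n => sG P Λ μ' δ hh (cs (pa n i)) (cs (pb n i))) = ⊤) :
    P.postOutC (List.ofFn fun u => ((cs u : ℕ))) = h := by
  -- the rows
  set rows : Fin n → ℕ → ℚ := fun i => P.deriveR (dec P (cs (pa n i))) (dec P (cs (pb n i))) with hrows
  set s : Fin n → Fin P.T → ZMod h := fun i => ((sG P Λ μ' δ hh (cs (pa n i)) (cs (pb n i)) : annih h Λ) : Fin P.T → ZMod h)
    with hs
  have hdec : ∀ j, P.decodeUnit (cs j : ℕ) = some (dec P (cs j : ℕ)) := fun j =>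
    (decodeUnit_of_mem_Acc (xiOf_spec (hacc j)).2).1
  have hpr : P.pairRowsR (List.ofFn fun u => ((cs u : ℕ))) = List.ofFn fun i => (List.range P.T).map (rows i) :=
    pairRowsR_ofFn P (fun u => (cs u : ℕ)) (fun u => dec P (cs u : ℕ)) hdec
  have hrep : ∀ (i : Fin n) (t : Fin P.T), ∃ m : ℤ, rows i t = ((s i t).val : ℚ) / h + m := fun i t =>
    exists_deriveR_eq_repQ_sG hh hhB hδ hδK (hacc _) (hacc _) t
  have hden : ∀ (i : Fin n) (t : Fin P.T), (rows i t).den ∣ h := by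
    intro i t
    obtain ⟨m, hm⟩ := hrep i t
    rw [hm, Rat.add_intCast_den]
    exact den_repQ_dvd (s i) t
  set N := lcmDen (List.ofFn fun i => (List.range P.T).map (rows i)) with hN
  have hNh : N ∣ h := lcmDen_ofFn_dvd rows hden
  have hN0 : N ≠ 0 := fun h0 => NeZero.ne h (Nat.eq_zero_of_zero_dvd (h0 ▸ hNh))
  have hNB : N ≤ P.B := (Nat.le_of_dvd (Nat.pos_of_ne_zero (NeZero.ne h)) hNh).trans hhB
  rw [PostParams.postOutC, hpr, if_pos hNB, PostParams.postOutR, hpr, ← hN,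
    subgroupOrderPure_natRows_eq_card rows s hrep hNh hN0 (fun i t => den_dvd_lcmDen_ofFn rows i t)]
  -- `closure (range s) = annih h Λ` has `h` elements
  have hrange : Set.range s = (annih h Λ).subtype '' Set.range (fun i : Fin n => sG P Λ μ' δ hh (cs (pa n i)) (cs (pb n i))) := by
    rw [← Set.range_comp]; rfl
  rw [hrange, ← AddMonoidHom.map_closure, hgen, AddSubgroup.card_map_of_injective (AddSubgroup.subtype_injective _),
    AddSubgroup.card_top]
  exact card_annih hh

end Correct

/-! ### The probability estimate -/

section Prob

variable {P : PostParams} {Λ : AddSubgroup (Fin P.T → ℤ)} [Λ.FiniteIndex] {μ' : Fin P.T → ℝ} {δ ε₁ ε₂ ε₃ : ℝ}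
  {w w₁ : ℕ → ℝ} {h : ℕ} [NeZero h]

/-- The product law of the `2n` units with outcome law `w` on `Fin Q`. [folklore] -/
def lawOf (w : ℕ → ℝ) (m Q : ℕ) : (u : Fin m) → Fin Q → ℝ := fun _ x => w x

omit [Λ.FiniteIndex] [NeZero h] in
/-- `lawOf` is a product of probability vectors. [folklore] -/
theorem isProbVec_lawOf (hw : ∀ c, 0 ≤ w c) {Q : ℕ} (hsum : ∑ c ∈ range Q, w c = 1) (m : ℕ) :
    PeriodFinding.IsProbVec (lawOf w m Q) :=
  ⟨fun _ x => hw x, fun u => by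
    show ∑ x : Fin Q, w x = 1
    rw [Fin.sum_univ_eq_sum_range, hsum]⟩

/-- **The single-pair bound**: the `w ⊗ w`-probability that both outcomes are accurate and the combination lands in a proper
subgroup `H` is `≤ (1+ε₂)²/2 · (1+ε₃)²`. [cite: Hallgren2005, §4] -/
theorem pair_prob_le (hh : Λ.index = h) (hhB : h ≤ P.B) (hδK : (4 * (P.K₀ : ℝ) + 2) * δ * (P.B : ℝ) ^ 2 < 1)
    (hδ : 0 ≤ δ) (hε₂ : 0 ≤ ε₂) (hw : ∀ c, 0 ≤ w c) (hsum : ∑ c ∈ range (2 ^ P.Lq), w c = 1)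
    (hdiff : ∑ c ∈ range (2 ^ P.Lq), |w c - w₁ c| ≤ ε₃) (hlaw : UnitSamplingLaw P Λ μ' δ ε₁ ε₂ w₁)
    (H : AddSubgroup (annih h Λ)) (hH : H ≠ ⊤) :
    ∑ x : Fin (2 ^ P.Lq), ∑ y : Fin (2 ^ P.Lq), (if ((x : ℕ), (y : ℕ)) ∈ pairEvSet P Λ μ' δ hh H then w x * w y else 0) ≤
      (1 + ε₂) ^ 2 / 2 * (1 + ε₃) ^ 2 := by
  haveI : Fintype (annih h Λ) := Fintype.ofFinite _
  have hcard : Fintype.card (annih h Λ) = h := by rw [← Nat.card_eq_fintype_card, card_annih hh]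
  have h1 : 1 ≤ h := Nat.pos_of_ne_zero (NeZero.ne h)
  -- `2δ < 1/h`
  have hsep : 2 * δ < 1 / (h : ℝ) := by
    have hB1 : (1 : ℝ) ≤ P.B := by exact_mod_cast h1.trans hhB
    have hhB' : (h : ℝ) ≤ P.B := by exact_mod_cast hhB
    have hK : (0 : ℝ) ≤ 4 * P.K₀ * δ * (P.B : ℝ) ^ 2 := by positivity
    have h2 : 2 * δ * (P.B : ℝ) ^ 2 < 1 := by nlinarith
    have e1 : 2 * δ * (h : ℝ) ≤ 2 * δ * P.B := mul_le_mul_of_nonneg_left hhB' (by linarith)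
    have e2 : 2 * δ * (P.B : ℝ) ≤ 2 * δ * (P.B : ℝ) ^ 2 := by
      have : (P.B : ℝ) ≤ (P.B : ℝ) ^ 2 := by nlinarith
      exact mul_le_mul_of_nonneg_left this (by linarith)
    rw [lt_div_iff₀ (by exact_mod_cast h1)]
    linarith
  set HF : Finset (annih h Λ) := univ.filter (· ∈ H) with hHF
  have hHF2 : 2 * HF.card ≤ Fintype.card (annih h Λ) := by
    have h2 := Hallgren2005.two_mul_card_le_of_ne_top hH
    rw [Nat.card_eq_fintype_card (α := annih h Λ)] at h2
    convert h2 using 2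
    rw [hHF, Nat.card_eq_fintype_card, Fintype.card_subtype]
  have key := sum_pair_event_le (univ : Finset (Fin (2 ^ P.Lq))) (fun x => (x : ℕ) ∈ AccAll P Λ μ' δ)
    (fun x => klab P x) (fun x => glab P Λ μ' δ hh x) (fun x => w x) (fun x => w₁ x) cf (ε₂ := ε₂) (ε₃ := ε₃) HF
    (fun x => hw x) (fun x => hlaw.1 x) (by rw [Fin.sum_univ_eq_sum_range, hsum])
    (by rw [Fin.sum_univ_eq_sum_range (fun c => |w c - w₁ c|)]; exact hdiff) ?_ (fun k k' => gcd_coefs _ _) hHF2 hε₂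
  · refine le_trans (le_of_eq (sum_congr rfl fun x _ => sum_congr rfl fun y _ => if_congr ?_ rfl rfl)) key
    simp only [pairEvSet, Set.mem_setOf_eq, sG, hHF, mem_filter, mem_univ, true_and]
  · intro kk g
    have hrepd : repQ h (g : Fin P.T → ZMod h) ∈ dualReps P.T Λ := ⟨repQ_nonneg_lt _, repQ_pairs_int g.2⟩
    rw [hcard]
    calc ∑ a ∈ univ.filter (fun a : Fin (2 ^ P.Lq) => (a : ℕ) ∈ AccAll P Λ μ' δ ∧ klab P a = kk ∧ glab P Λ μ' δ hh a = g), w₁ a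
        = ∑ c ∈ (range (2 ^ P.Lq)).filter (fun c => c ∈ Acc P μ' δ kk (repQ h (g : Fin P.T → ZMod h))), w₁ c := by
          rw [sum_filter, sum_filter, ← Fin.sum_univ_eq_sum_range]
          exact sum_congr rfl fun a _ => if_congr (mem_Acc_repQ_iff hh hsep kk g a).symm rfl rfl
      _ ≤ (1 + ε₂) / (Λ.index : ℝ) *
          ∑ c ∈ (range (2 ^ P.Lq)).filter (fun c => ∃ ξ' ∈ dualReps P.T Λ, c ∈ Acc P μ' δ kk ξ'), w₁ c := hlaw.2.2 kk _ hrepd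
      _ = (1 + ε₂) / (h : ℝ) * ∑ a ∈ univ.filter (fun a : Fin (2 ^ P.Lq) => (a : ℕ) ∈ AccAll P Λ μ' δ ∧ klab P a = kk), w₁ a := by
          rw [sum_filter, sum_filter, ← Fin.sum_univ_eq_sum_range, hh]
          congr 1
          exact sum_congr rfl fun a _ => if_congr (exists_mem_Acc_iff hh hsep kk a) rfl rfl

/-- **The failure bound**: `P(success) ≥ 1 − 2n(ε₁+ε₃) − #Sub(G) · ((1+ε₂)²/2 (1+ε₃)²)^n`. [cite: Hallgren2005, §4; Kitaev1995, §4] -/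
theorem success_ge (hh : Λ.index = h) (hhB : h ≤ P.B) (hδK : (4 * (P.K₀ : ℝ) + 2) * δ * (P.B : ℝ) ^ 2 < 1)
    (hδ : 0 ≤ δ) (hε₂ : 0 ≤ ε₂) (hw : ∀ c, 0 ≤ w c) (hsum : ∑ c ∈ range (2 ^ P.Lq), w c = 1)
    (hdiff : ∑ c ∈ range (2 ^ P.Lq), |w c - w₁ c| ≤ ε₃) (hlaw : UnitSamplingLaw P Λ μ' δ ε₁ ε₂ w₁) (n : ℕ)
    [Fintype (AddSubgroup (annih h Λ))] :
    1 - (2 * n * (ε₁ + ε₃) + Nat.card (AddSubgroup (annih h Λ)) * ((1 + ε₂) ^ 2 / 2 * (1 + ε₃) ^ 2) ^ n) ≤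
      ∑ cs : Fin (2 * n) → Fin (2 ^ P.Lq),
        if P.postOutC (List.ofFn fun u => ((cs u : ℕ))) = Λ.index then ∏ u, w (cs u) else 0 := by
  set Q := 2 ^ P.Lq with hQ
  set μ := lawOf w (2 * n) Q with hμ
  have hpv : PeriodFinding.IsProbVec μ := isProbVec_lawOf hw hsum (2 * n)
  -- events
  set Succ : Finset (Fin (2 * n) → Fin Q) := univ.filter fun cs => P.postOutC (List.ofFn fun u => ((cs u : ℕ))) = Λ.index
    with hSucc
  set Bad : Finset (Fin (2 * n) → Fin Q) := univ.filter fun cs => ∃ u, (cs u : ℕ) ∉ AccAll P Λ μ' δ with hBad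
  set EH : AddSubgroup (annih h Λ) → Finset (Fin (2 * n) → Fin Q) := fun H => univ.filter fun cs => ∀ i : Fin n,
    ((cs (pa n i) : ℕ), (cs (pb n i) : ℕ)) ∈ pairEvSet P Λ μ' δ hh H with hEH
  set Hs : Finset (AddSubgroup (annih h Λ)) := univ.filter fun H => H ≠ ⊤ with hHs
  -- the target is `prob μ Succ`
  have htarget : (∑ cs : Fin (2 * n) → Fin Q, if P.postOutC (List.ofFn fun u => ((cs u : ℕ))) = Λ.index
      then ∏ u, w (cs u) else 0) = PeriodFinding.prob μ Succ := by
    rw [PeriodFinding.prob, hSucc, sum_filter]; rfl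
  rw [htarget]
  -- covering of the failure event
  have hcover : Succᶜ ⊆ Bad ∪ Hs.biUnion EH := by
    intro cs hcs
    rw [mem_compl, hSucc, mem_filter, not_and] at hcs
    have hfail := hcs (mem_univ _)
    by_cases hb : ∃ u, (cs u : ℕ) ∉ AccAll P Λ μ' δ
    · exact mem_union_left _ (by rw [hBad, mem_filter]; exact ⟨mem_univ _, hb⟩)
    · push Not at hb
      have hgen : AddSubgroup.closure (Set.range fun i : Fin n => sG P Λ μ' δ hh (cs (pa n i)) (cs (pb n i))) ≠ ⊤ :=
        fun hg => hfail (by rw [postOutC_eq_of_generate hh hhB hδ hδK cs hb hg, hh])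
      refine mem_union_right _ (mem_biUnion.2 ⟨_, by rw [hHs, mem_filter]; exact ⟨mem_univ _, hgen⟩, ?_⟩)
      rw [hEH, mem_filter]
      exact ⟨mem_univ _, fun i => ⟨hb _, hb _, AddSubgroup.subset_closure ⟨i, rfl⟩⟩⟩
  -- the bad units
  have hbad : PeriodFinding.prob μ Bad ≤ 2 * n * (ε₁ + ε₃) := by
    have hunit : ∀ u : Fin (2 * n), PeriodFinding.prob μ (univ.filter fun cs : Fin (2 * n) → Fin Q =>
        cs u ∈ (univ : Finset (Fin Q)).filter fun x : Fin Q => (x : ℕ) ∉ AccAll P Λ μ' δ) ≤ ε₁ + ε₃ := by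
      intro u
      rw [PeriodFinding.prob_filter_apply hpv]
      have e : (∑ x ∈ (univ : Finset (Fin Q)).filter (fun x : Fin Q => (x : ℕ) ∉ AccAll P Λ μ' δ), μ u x) =
          ∑ c ∈ (range Q).filter (fun c => c ∉ AccAll P Λ μ' δ), w c := by
        rw [sum_filter, sum_filter]
        exact Fin.sum_univ_eq_sum_range (fun c => if c ∉ AccAll P Λ μ' δ then w c else 0) Q
      rw [e]
      calc ∑ c ∈ (range Q).filter (fun c => c ∉ AccAll P Λ μ' δ), w c
          ≤ ∑ c ∈ (range Q).filter (fun c => c ∉ AccAll P Λ μ' δ), (w₁ c + |w c - w₁ c|) :=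
            sum_le_sum fun c _ => by linarith [le_abs_self (w c - w₁ c)]
        _ = ∑ c ∈ (range Q).filter (fun c => c ∉ AccAll P Λ μ' δ), w₁ c +
              ∑ c ∈ (range Q).filter (fun c => c ∉ AccAll P Λ μ' δ), |w c - w₁ c| := sum_add_distrib
        _ ≤ ε₁ + ε₃ := add_le_add hlaw.2.1
            ((sum_le_sum_of_subset_of_nonneg (filter_subset _ _) fun c _ _ => abs_nonneg _).trans hdiff)
    have hsub : Bad ⊆ (univ : Finset (Fin (2 * n))).biUnion fun u => univ.filter fun cs : Fin (2 * n) → Fin Q =>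
        cs u ∈ (univ : Finset (Fin Q)).filter fun x : Fin Q => (x : ℕ) ∉ AccAll P Λ μ' δ := by
      intro cs hcs
      rw [hBad, mem_filter] at hcs
      obtain ⟨u, hu⟩ := hcs.2
      exact mem_biUnion.2 ⟨u, mem_univ _, by rw [mem_filter]; exact ⟨mem_univ _, by rw [mem_filter]; exact ⟨mem_univ _, hu⟩⟩⟩
    calc PeriodFinding.prob μ Bad ≤ _ := PeriodFinding.prob_mono hpv hsub
      _ ≤ ∑ u : Fin (2 * n), PeriodFinding.prob μ (univ.filter fun cs : Fin (2 * n) → Fin Q =>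
          cs u ∈ (univ : Finset (Fin Q)).filter fun x : Fin Q => (x : ℕ) ∉ AccAll P Λ μ' δ) := PeriodFinding.prob_biUnion_le hpv _ _
      _ ≤ ∑ _u : Fin (2 * n), (ε₁ + ε₃) := sum_le_sum fun u _ => hunit u
      _ = 2 * n * (ε₁ + ε₃) := by rw [sum_const, card_univ, Fintype.card_fin, nsmul_eq_mul]; push_cast; ring
  -- each generation-failure event
  set q₀ : ℝ := (1 + ε₂) ^ 2 / 2 * (1 + ε₃) ^ 2 with hq₀
  have hEHle : ∀ H ∈ Hs, PeriodFinding.prob μ (EH H) ≤ q₀ ^ n := by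
    intro H hHm
    have hHne : H ≠ ⊤ := (mem_filter.1 hHm).2
    have hpair : ∀ i : Fin n, PeriodFinding.prob μ (univ.filter fun cs : Fin (2 * n) → Fin Q =>
        ((cs (pa n i) : ℕ), (cs (pb n i) : ℕ)) ∈ pairEvSet P Λ μ' δ hh H) ≤ q₀ := by
      intro i
      have hne : pa n i ≠ pb n i := fun e => (disjointPairs_pa_pb n).a_ne_b i i e
      rw [PeriodFinding.prob, sum_filter]
      have e : (∑ cs : Fin (2 * n) → Fin Q, if ((cs (pa n i) : ℕ), (cs (pb n i) : ℕ)) ∈ pairEvSet P Λ μ' δ hh H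
            then PeriodFinding.pw μ cs else 0) =
          ∑ cs : Fin (2 * n) → Fin Q, PeriodFinding.pw μ cs *
            (fun x y : Fin Q => if ((x : ℕ), (y : ℕ)) ∈ pairEvSet P Λ μ' δ hh H then (1 : ℝ) else 0) (cs (pa n i)) (cs (pb n i)) :=
        sum_congr rfl fun cs _ => by simp only []; split_ifs <;> simp
      rw [e, PeriodFinding.sum_pw_mul_apply₂ hpv hne (fun x y : Fin Q => if ((x : ℕ), (y : ℕ)) ∈ pairEvSet P Λ μ' δ hh H then (1 : ℝ) else 0)]
      calc ∑ x : Fin Q, ∑ y : Fin Q, μ (pa n i) x * μ (pb n i) y * (if ((x : ℕ), (y : ℕ)) ∈ pairEvSet P Λ μ' δ hh H then (1 : ℝ) else 0)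
          = ∑ x : Fin Q, ∑ y : Fin Q, (if ((x : ℕ), (y : ℕ)) ∈ pairEvSet P Λ μ' δ hh H then w x * w y else 0) :=
            sum_congr rfl fun x _ => sum_congr rfl fun y _ => by split_ifs <;> simp [hμ, lawOf]
        _ ≤ q₀ := pair_prob_le hh hhB hδK hδ hε₂ hw hsum hdiff hlaw H hHne
    have hq0 : 0 ≤ q₀ := by positivity
    have hprod := PeriodFinding.prob_forall_not_eq_prod hpv (disjointPairs_pa_pb n)
      (fun _ (x y : Fin Q) => ¬ ((x : ℕ), (y : ℕ)) ∈ pairEvSet P Λ μ' δ hh H) univ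
    have hEq : PeriodFinding.prob μ (EH H) = ∏ i ∈ (univ : Finset (Fin n)), (1 - PeriodFinding.prob μ
        (univ.filter fun cs : Fin (2 * n) → Fin Q => ¬ ((cs (pa n i) : ℕ), (cs (pb n i) : ℕ)) ∈ pairEvSet P Λ μ' δ hh H)) := by
      convert hprod using 3
      simp
    have hfac : ∀ i ∈ (univ : Finset (Fin n)), 1 - PeriodFinding.prob μ (univ.filter fun cs : Fin (2 * n) → Fin Q =>
        ¬ ((cs (pa n i) : ℕ), (cs (pb n i) : ℕ)) ∈ pairEvSet P Λ μ' δ hh H) =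
        PeriodFinding.prob μ (univ.filter fun cs : Fin (2 * n) → Fin Q => ((cs (pa n i) : ℕ), (cs (pb n i) : ℕ)) ∈ pairEvSet P Λ μ' δ hh H) := by
      intro i _
      have hc := PeriodFinding.prob_compl hpv
        (univ.filter fun cs : Fin (2 * n) → Fin Q => ((cs (pa n i) : ℕ), (cs (pb n i) : ℕ)) ∈ pairEvSet P Λ μ' δ hh H)
      rw [compl_filter] at hc
      linarith
    rw [hEq, prod_congr rfl hfac]
    calc ∏ i : Fin n, PeriodFinding.prob μ (univ.filter fun cs : Fin (2 * n) → Fin Q =>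
          ((cs (pa n i) : ℕ), (cs (pb n i) : ℕ)) ∈ pairEvSet P Λ μ' δ hh H)
        ≤ ∏ _i : Fin n, q₀ := prod_le_prod (fun i _ => PeriodFinding.prob_nonneg hpv _) fun i _ => hpair i
      _ = q₀ ^ n := by rw [prod_const, card_univ, Fintype.card_fin]
  -- assemble
  have hHs : (Hs.card : ℝ) ≤ Nat.card (AddSubgroup (annih h Λ)) := by
    rw [Nat.card_eq_fintype_card]
    exact_mod_cast (card_filter_le _ _).trans (card_univ (α := AddSubgroup (annih h Λ))).le
  have hq0' : 0 ≤ q₀ ^ n := by positivity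
  have hfailure : PeriodFinding.prob μ Succᶜ ≤ 2 * n * (ε₁ + ε₃) + Nat.card (AddSubgroup (annih h Λ)) * q₀ ^ n := by
    calc PeriodFinding.prob μ Succᶜ ≤ PeriodFinding.prob μ (Bad ∪ Hs.biUnion EH) := PeriodFinding.prob_mono hpv hcover
      _ ≤ PeriodFinding.prob μ Bad + PeriodFinding.prob μ (Hs.biUnion EH) := PeriodFinding.prob_union_le hpv _ _
      _ ≤ 2 * n * (ε₁ + ε₃) + ∑ H ∈ Hs, PeriodFinding.prob μ (EH H) := add_le_add hbad (PeriodFinding.prob_biUnion_le hpv _ _)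
      _ ≤ 2 * n * (ε₁ + ε₃) + ∑ _H ∈ Hs, q₀ ^ n := by gcongr with H hH; exact hEHle H hH
      _ ≤ 2 * n * (ε₁ + ε₃) + Nat.card (AddSubgroup (annih h Λ)) * q₀ ^ n := by
          rw [sum_const, nsmul_eq_mul]
          exact add_le_add le_rfl (mul_le_mul_of_nonneg_right hHs hq0')
  have hcompl := PeriodFinding.prob_compl hpv Succ
  linarith

end Prob

/-! ### The registered statement -/

/-- (REGISTERED SIGNATURE — do not change.) **S5b-P7 `stub_classPost`**: the exact-modes / coprime-pairing post-processing
succeeds (`ClaimPost`, `Literature/Computability/Cryptography/CubicClassSamplingSpecs.lean`). [cite: Hallgren2005, §4; Kitaev1995, §4] -/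
theorem stub_classPost : ClaimPost := by
  intro P Λ _ μ' δ ε₁ ε₂ ε₃ w w₁ n hT hidx hδK hδ hε₁ hε₂ hε₃ hw hsum hdiff hlaw
  set h := Λ.index with hhdef
  haveI : NeZero h := ⟨AddSubgroup.FiniteIndex.index_ne_zero⟩
  haveI : Fintype (annih h Λ) := Fintype.ofFinite _
  haveI : Fintype (AddSubgroup (annih h Λ)) := @Fintype.ofFinite _ Hallgren2005.finite_addSubgroup
  have hcardG : Fintype.card (annih h Λ) = h := by rw [← Nat.card_eq_fintype_card, card_annih rfl]
  have h1 : 1 ≤ h := Nat.pos_of_ne_zero (NeZero.ne h)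
  set q : ℝ := (1 + ε₂) ^ 2 / 2 + 3 * (ε₁ + ε₃) with hq
  set q₀ : ℝ := (1 + ε₂) ^ 2 / 2 * (1 + ε₃) ^ 2 with hq₀
  set L : ℕ := Nat.log 2 P.B + 2 with hL
  have hnonneg : 0 ≤ ∑ cs : Fin (2 * n) → Fin (2 ^ P.Lq),
      (if P.postOutC (List.ofFn fun u => ((cs u : ℕ))) = Λ.index then ∏ u, w (cs u) else 0) :=
    sum_nonneg fun cs _ => by split_ifs; exacts [prod_nonneg fun u _ => hw _, le_rfl]
  have hBL : (1 : ℝ) ≤ ((P.B : ℝ) + 1) ^ L := one_le_pow₀ (by linarith [(Nat.cast_nonneg P.B : (0 : ℝ) ≤ P.B)])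
  by_cases hq1 : 1 ≤ q
  · -- the claimed bound is `≤ 0`
    have hqn : (1 : ℝ) ≤ q ^ n := one_le_pow₀ hq1
    have hn0 : (0 : ℝ) ≤ 2 * n * (ε₁ + ε₃) := by positivity
    nlinarith
  · push Not at hq1
    have hq0 : 0 ≤ q₀ := by positivity
    have hε₃1 : ε₃ ≤ 1 := by nlinarith [sq_nonneg (1 + ε₂)]
    have hκ : (1 + ε₂) ^ 2 ≤ 2 := by nlinarith
    have hq₀q : q₀ ≤ q := (half_sq_mul_sq_le hκ hε₃ hε₃1).trans (by rw [hq]; nlinarith)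
    have hmain := success_ge (P := P) (Λ := Λ) (μ' := μ') rfl hidx hδK hδ hε₂ hw hsum hdiff hlaw n
    -- `#Sub(G) ≤ (B+1)^(log₂ B + 2)`
    have hsubs : (Nat.card (AddSubgroup (annih h Λ)) : ℝ) ≤ ((P.B : ℝ) + 1) ^ L := by
      have h0 := Hallgren2005.card_addSubgroup_le (H := annih h Λ)
      rw [hcardG] at h0
      have h2 : (h + 1) ^ Nat.log 2 h ≤ (P.B + 1) ^ L :=
        (Nat.pow_le_pow_left (by omega) _).trans (Nat.pow_le_pow_right (by omega) ((Nat.log_mono_right hidx).trans (by omega)))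
      exact_mod_cast h0.trans h2
    have hpow : q₀ ^ n ≤ q ^ n := pow_le_pow_left₀ hq0 hq₀q n
    have : (Nat.card (AddSubgroup (annih h Λ)) : ℝ) * q₀ ^ n ≤ ((P.B : ℝ) + 1) ^ L * q ^ n :=
      mul_le_mul hsubs hpow (pow_nonneg hq0 n) (by positivity)
    linarith

end Summit.QuantumAdvantage.QuantumAdvantage.Theorems.LinnikCubicClassGroups

end
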